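import Summits.CriticalPhenomena.PercolationContinuityZ3.Theorems.SahiMasterFamilySparseEndExpansion
import Summits.CriticalPhenomena.PercolationContinuityZ3.Theorems.SahiMasterFamily

/-!
# The principal-cap dichotomy, III: families of pairwise disjoint cylinders are identically zero, every order

Support file of the master-family programme (crux `NoHeavyLowerTail`, stmt-CriticalPhenomena-4575; cell `prim-masterthm`, seat P4,
unit `prim-masterthm-p4-g6`).  Seat document HOME/prim-masterthm-p4/PROOF-PCD.md §2 (2b) (the all-cylinder branch of the KeyStep).

Under the sparse product weight `spw w p` (`SahiMasterFamilySparseEndExpansion`; any real `w`, `p` — a signed product weight of total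
mass one) the cylinder events `cyl A = {ω : A ⊆ ω}` (written inline as `univ.filter (A ⊆ ·)`) satisfy `E[1_{cyl A}] = ∏_{e∈A} p w_e` (`ex_spw_setInd_cyl`) and
`1_{cyl A}·1_{cyl B} = 1_{cyl (A ∪ B)}`; hence `Cov(1_{cyl A}, 1_{cyl B}) = 0` for disjoint `A, B`, and by the Lieb–Sahi recursion peeled at
slot `0` (the tree's zero-flag class `SahiZeroFlag`, `SahiMasterFamily`) every family of PAIRWISE DISJOINT cylinders is a zero flag:
**`sahiE_spw_cyl_eq_zero`**: `E_{n+2}(spw w p; 1_{cyl κ_0},…,1_{cyl κ_{n+1}}) = 0` for pairwise disjoint `κ_j`, all `n`, all `w`, `p`.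
HONEST FRAMING: elementary; [this work].  Nothing here bears on `C_n` [Sahi2008, Conj. 5].
-/

namespace Summit.CriticalPhenomena.PercolationContinuityZ3.Theorems

namespace SahiSparseEnd

open Finset Function
open Literature.Combinatorics.Sahi2008

variable {ι : Type*} [Fintype ι] [DecidableEq ι]

/-! ### Cylinders `cyl A := univ.filter (A ⊆ ·)` (written inline; no new definition) -/

omit [DecidableEq ι] in
/-- Membership in a cylinder. [this work] -/
theorem mem_cyl [DecidableEq ι] {A ω : Finset ι} : ω ∈ (univ.filter fun ω => A ⊆ ω) ↔ A ⊆ ω := by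
  simp

/-- `cyl A ∩ cyl B = cyl (A ∪ B)`. [this work] -/
theorem cyl_inter (A B : Finset ι) :
    (univ.filter fun ω => A ⊆ ω) ∩ (univ.filter fun ω => B ⊆ ω) = univ.filter fun ω => A ∪ B ⊆ ω := by
  ext ω
  rw [mem_inter, mem_cyl, mem_cyl, mem_cyl, union_subset_iff]

/-- `1_{cyl A} · 1_{cyl B} = 1_{cyl (A ∪ B)}`. [this work] -/
theorem setInd_cyl_mul (A B : Finset ι) :
    setInd (univ.filter fun ω => A ⊆ ω) * setInd (univ.filter fun ω => B ⊆ ω) = setInd (univ.filter fun ω => A ∪ B ⊆ ω) := by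
  rw [setInd_mul, cyl_inter]

/-- **`E_{spw w p}[1_{cyl A}] = ∏_{e ∈ A} (p w_e)`** (marginal of the signed product weight). [this work] -/
theorem ex_spw_setInd_cyl (w : ι → ℝ) (p : ℝ) (A : Finset ι) :
    ex (spw w p) (setInd (univ.filter fun ω => A ⊆ ω)) = ∏ e ∈ A, p * w e := by
  have h := prod_add (fun e => p * w e) (fun e => 1 - p * w e) (univ \ A)
  simp only [add_sub_cancel, prod_const_one] at h
  have h1 : ex (spw w p) (setInd (univ.filter fun ω => A ⊆ ω)) = ∑ ω ∈ univ.filter (fun ω => A ⊆ ω), spw w p ω := by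
    rw [ex]
    simp only [setInd_apply, mul_ite, mul_one, mul_zero]
    rw [← sum_filter, filter_mem_eq_inter, univ_inter]
  rw [h1]
  calc ∑ ω ∈ univ.filter (fun ω => A ⊆ ω), spw w p ω = ∑ t ∈ (univ \ A).powerset, spw w p (A ∪ t) := by
        refine sum_nbij' (fun ω => ω \ A) (fun t => A ∪ t) ?_ ?_ ?_ ?_ ?_
        · intro ω _; rw [mem_powerset]; exact sdiff_subset_sdiff (subset_univ _) subset_rfl
        · intro t _; rw [mem_cyl]; exact subset_union_left
        · intro ω hω; rw [mem_cyl] at hω; exact union_sdiff_of_subset hω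
        · intro t ht
          rw [mem_powerset] at ht
          exact union_sdiff_cancel_left (disjoint_sdiff.mono_right ht)
        · intro ω hω; rw [mem_cyl] at hω; rw [union_sdiff_of_subset hω]
    _ = ∑ t ∈ (univ \ A).powerset, (∏ e ∈ A, p * w e) * ((∏ e ∈ t, p * w e) * ∏ e ∈ (univ \ A) \ t, (1 - p * w e)) := by
        refine sum_congr rfl fun t ht => ?_
        rw [mem_powerset] at ht
        have hdis : Disjoint A t := disjoint_sdiff.mono_right ht
        have hs : univ \ (A ∪ t) = (univ \ A) \ t := by
          ext e; simp only [mem_sdiff, mem_union, mem_univ, true_and]; tauto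
        rw [spw, prod_union hdis, hs, mul_assoc]
    _ = (∏ e ∈ A, p * w e) * 1 := by rw [← mul_sum, ← h]
    _ = ∏ e ∈ A, p * w e := mul_one _

/-- **Disjoint cylinders are uncorrelated** under every sparse product weight: `E[1_{cyl A} 1_{cyl B}] = E[1_{cyl A}] E[1_{cyl B}]`.
[this work] -/
theorem ex_spw_setInd_cyl_mul (w : ι → ℝ) (p : ℝ) {A B : Finset ι} (hAB : Disjoint A B) :
    ex (spw w p) (setInd (univ.filter fun ω => A ⊆ ω) * setInd (univ.filter fun ω => B ⊆ ω)) =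
      ex (spw w p) (setInd (univ.filter fun ω => A ⊆ ω)) * ex (spw w p) (setInd (univ.filter fun ω => B ⊆ ω)) := by
  rw [setInd_cyl_mul, ex_spw_setInd_cyl, ex_spw_setInd_cyl, ex_spw_setInd_cyl, prod_union hAB]

/-! ### Disjoint cylinder families are zero flags -/

/-- A family of pairwise disjoint cylinders is a zero flag (tree `SahiZeroFlag`) of every order `≥ 2` under `spw w p`: peel slot `0`;
the deleted family and the modified families (`cyl κ_l ∩ cyl κ_0 = cyl (κ_l ∪ κ_0)`) are again pairwise disjoint cylinder families.
[this work] -/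
theorem sahiZeroFlag_cyl (w : ι → ℝ) (p : ℝ) : ∀ (n : ℕ) (κ : Fin (n + 2) → Finset ι),
    (∀ i j, i ≠ j → Disjoint (κ i) (κ j)) → SahiZeroFlag (spw w p) (n + 2) (fun j => setInd (univ.filter fun ω => κ j ⊆ ω))
  | 0, κ, hκ => by
    show sahiE (spw w p) 2 _ = 0
    rw [sahiE_two_apply, ex_spw_setInd_cyl_mul w p (hκ 0 1 (by decide)), sub_self]
  | n + 1, κ, hκ => by
    have h0j : ∀ j : Fin (n + 2), (0 : Fin (n + 3)) ≠ (0 : Fin (n + 3)).succAbove j := fun j => (Fin.succAbove_ne 0 j).symm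
    refine ⟨0, ?_, fun l => ?_⟩
    · exact sahiZeroFlag_cyl w p n (fun j => κ ((0 : Fin (n + 3)).succAbove j)) fun i j hij =>
        hκ _ _ fun h => hij (Fin.succAbove_right_injective h)
    · have hfam : update (fun j => setInd (univ.filter fun ω => κ ((0 : Fin (n + 3)).succAbove j) ⊆ ω)) l
          (setInd (univ.filter fun ω => κ ((0 : Fin (n + 3)).succAbove l) ⊆ ω) * setInd (univ.filter fun ω => κ 0 ⊆ ω)) =
          fun j => setInd (univ.filter fun ω =>
            update (fun j => κ ((0 : Fin (n + 3)).succAbove j)) l (κ ((0 : Fin (n + 3)).succAbove l) ∪ κ 0) j ⊆ ω) := by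
        funext j
        rw [update_apply, update_apply]
        split_ifs with h
        · rw [setInd_cyl_mul]
        · rfl
      rw [hfam]
      refine sahiZeroFlag_cyl w p n _ fun i j hij => ?_
      rw [update_apply, update_apply]
      split_ifs with hi hj hj
      · exact absurd (hi.trans hj.symm) hij
      · rw [disjoint_union_left]
        exact ⟨hκ _ _ fun h => hij (hi.trans (Fin.succAbove_right_injective h)), hκ _ _ (h0j j)⟩
      · rw [disjoint_union_right]
        exact ⟨hκ _ _ fun h => hij ((Fin.succAbove_right_injective h).trans hj.symm), (hκ _ _ (h0j i)).symm⟩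
      · exact hκ _ _ fun h => hij (Fin.succAbove_right_injective h)

/-- **`E_{n+2}(spw w p; 1_{cyl κ_0}, …, 1_{cyl κ_{n+1}}) = 0`** for pairwise disjoint `κ_j`, every order, every `w`, `p`. [this work] -/
theorem sahiE_spw_cyl_eq_zero (w : ι → ℝ) (p : ℝ) {n : ℕ} (κ : Fin (n + 2) → Finset ι)
    (hκ : ∀ i j, i ≠ j → Disjoint (κ i) (κ j)) :
    sahiE (spw w p) (n + 2) (fun j => setInd (univ.filter fun ω => κ j ⊆ ω)) = 0 :=
  sahiE_eq_zero_of_sahiZeroFlag _ _ _ (sahiZeroFlag_cyl w p n κ hκ)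

end SahiSparseEnd

end Summit.CriticalPhenomena.PercolationContinuityZ3.Theorems
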